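import Summits.CriticalPhenomena.SAWScalingLimit.Theorems.SAWLeftRightFKGFKGToTraversalBoundWitnessRestClass
import Summits.CriticalPhenomena.SAWScalingLimit.Theorems.SAWLeftRightFKGFKGToTraversalBoundWitnessMonoOneSided
import HarnessLib

/-!
# Witness glue T5, part 3: piece facts and escapes of a far-tip configuration

Crux `SAWLeftRightFKG.FKGToTraversalBound` (stmt-CriticalPhenomena-1878), line `slit-necklace`, lead
prover-line-stmt-CriticalPhenomena-1878-c5-0; witness glue unit T5 (block-monotone contact index on a far piece
along the outline arc), part 3 of 4, on top of the vocabulary `…WitnessCfg` (`FarTipCfg`) and the rest-class file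
`…WitnessRestClass` (`rest_isPiece_pend`, `rest_notMem_Λ_of_mem_support`, walks along the chord).

For a far-tip configuration `cfg`, a far start `i'' ≠ cfg.i` with its piece `(i'', cfg.pend i'')`, and a site
set `F ⊆ Λ` off the attached set `K` (the free component): PIECE FACTS (`mono_sep`: the piece lies entirely
before `cfg.i` or after `cfg.j`, so its vertices are exterior, `mono_mem_K`; interior vertices of a
non-degenerate piece are lattice-domain sites, `mono_interior_mem_Λ`), and ESCAPES (`mono_escapes`, registered):
an abscissa `Rbig` beyond `F`, the piece and the trace of `C`, and from every site of `K ∪ C.support` that is not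
an interior vertex of the piece a lattice walk avoiding `F` and the interior of the piece to abscissa `≥ Rbig` —
from a trace site east of the trace (`Negative.noFloatingHoles`) then due east (`mono_eastWalk`); from a spine
site along its attachment walk (`cfg.hatt`) to the trace; from an exterior chord vertex along the chord, away
from the middle of the piece `cfg.i`, to the nearest spine vertex.

All statements folklore; no literature fact; nothing restates the crux.
-/

noncomputable section

open Set
open Literature.Probability.LatticeModels
open Literature.Probability.RandomPlanarGeometry
open Summit.CriticalPhenomena.SAWScalingLimit.Theorems.FKGToTraversalBound.Negative (dom)

namespace Summit.CriticalPhenomena.SAWScalingLimit.Theorems.FKGToTraversalBound.SlitNecklace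

variable {D : DobrushinDomain}

/-! ### Piece facts -/

/-- The chord is injective on its index range. [folklore] -/
theorem mono_γ_inj (cfg : FarTipCfg D) {m m' : ℕ} (hm : m ≤ cfg.γ.length) (hm' : m' ≤ cfg.γ.length)
    (h : cfg.γ.getVert m = cfg.γ.getVert m') : m = m' :=
  cfg.hγ.getVert_injOn (by simpa using hm) (by simpa using hm') h

/-- **Pieces do not interleave**: the piece of a far start `i'' ≠ cfg.i` ends at or before `cfg.i`, or starts
at or after `cfg.j`. [folklore] -/
theorem mono_sep (cfg : FarTipCfg D) {i'' : ℕ} (h : i'' ∈ cfg.farStarts) (hne : i'' ≠ cfg.i) :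
    cfg.pend i'' ≤ cfg.i ∨ cfg.j ≤ i'' := by
  have hP : IsPiece cfg.γ (↑cfg.Sp) cfg.i cfg.j := cfg.hft.1
  have hR := rest_isPiece_pend cfg h
  rcases lt_or_gt_of_ne hne with hlt | hlt
  · refine Or.inl (le_of_not_gt fun hcon => ?_)
    exact hR.2.2.2 cfg.i hlt hcon hP.1.2
  · refine Or.inr (le_of_not_gt fun hcon => ?_)
    exact hP.2.2.2 i'' hlt hcon hR.1.2

/-- The indices of the piece of `i'' ≠ cfg.i` are exterior to the middle `[τ, τ']`. [folklore] -/
theorem mono_idx_out (cfg : FarTipCfg D) {i'' : ℕ} (h : i'' ∈ cfg.farStarts) (hne : i'' ≠ cfg.i) {m : ℕ}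
    (h1 : i'' ≤ m) (h2 : m ≤ cfg.pend i'') : m < cfg.τ ∨ cfg.τ' < m := by
  have := cfg.idx_facts
  rcases mono_sep cfg h hne with h' | h' <;> omega

/-- **The vertices of the piece of `i'' ≠ cfg.i` are attached** (`∈ K`, indeed exterior). [folklore] -/
theorem mono_mem_K (cfg : FarTipCfg D) {i'' : ℕ} (h : i'' ∈ cfg.farStarts) (hne : i'' ≠ cfg.i) {m : ℕ}
    (h1 : i'' ≤ m) (h2 : m ≤ cfg.pend i'') : cfg.γ.getVert m ∈ cfg.K := by
  rw [FarTipCfg.K_def, Finset.mem_union]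
  exact Or.inr (cfg.mem_Ext_iff.2 ⟨m, h2.trans (rest_isPiece_pend cfg h).2.1.1, mono_idx_out cfg h hne h1 h2, rfl⟩)

/-- The vertex before the first tip is not an interior vertex of the piece of `i'' ≠ cfg.i`. [folklore] -/
theorem mono_pred_tip_ne (cfg : FarTipCfg D) {i'' : ℕ} (h : i'' ∈ cfg.farStarts) (hne : i'' ≠ cfg.i) {m : ℕ}
    (h1 : i'' < m) (h2 : m < cfg.pend i'') : cfg.γ.getVert (cfg.τ - 1) ≠ cfg.γ.getVert m := by
  intro heq
  have hf := cfg.idx_facts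
  have hL := (rest_isPiece_pend cfg h).2.1.1
  have hm : cfg.τ - 1 = m := mono_γ_inj cfg (by omega) (by omega) heq
  rcases mono_sep cfg h hne with h' | h' <;> omega

/-- Interior vertices of a piece are off the spine. [folklore] -/
theorem mono_interior_notMem_Sp (cfg : FarTipCfg D) {i'' : ℕ} (h : i'' ∈ cfg.farStarts) {m : ℕ} (h1 : i'' < m)
    (h2 : m < cfg.pend i'') : cfg.γ.getVert m ∉ cfg.Sp := fun hm =>
  (rest_isPiece_pend cfg h).2.2.2 m h1 h2 (Finset.mem_coe.2 hm)

/-- **Interior vertices of a NON-DEGENERATE piece are lattice-domain sites**: such a vertex and one of its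
chord neighbours are both interior, hence off `S`, so the chord edge between them is a carrier edge (`cfg.hid`).
[folklore] -/
theorem mono_interior_mem_Λ (cfg : FarTipCfg D) {i'' : ℕ} (h : i'' ∈ cfg.farStarts) (hnd : cfg.NonDeg i'') {m : ℕ}
    (h1 : i'' < m) (h2 : m < cfg.pend i'') : cfg.γ.getVert m ∈ cfg.Λ := by
  have hR := rest_isPiece_pend cfg h
  have hnd' : i'' + 3 ≤ cfg.pend i'' := hnd
  have hL := hR.2.1.1
  have hS : ∀ a, i'' < a → a < cfg.pend i'' → cfg.γ.getVert a ∉ cfg.S := fun a ha ha' hs =>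
    hR.2.2.2 a ha ha' (Finset.mem_coe.2 (Finset.mem_union_right _ hs))
  have key : ∀ a, i'' < a → a + 1 < cfg.pend i'' → cfg.G.Adj (cfg.γ.getVert a) (cfg.γ.getVert (a + 1)) := by
    intro a ha ha1
    have hadj : cfg.Dg.Adj (cfg.γ.getVert a) (cfg.γ.getVert (a + 1)) := cfg.γ.adj_getVert_succ (by omega)
    exact (cfg.hid _ _).2 ⟨hadj, hS a ha (by omega), hS (a + 1) (by omega) ha1⟩
  show cfg.γ.getVert m ∈ meshDomain (dom cfg.C cfg.δ) cfg.δ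
  by_cases hm : m + 1 < cfg.pend i''
  · exact (discreteDomainGraph_adj_iff.1 (key m h1 hm)).2.1
  · have := key (m - 1) (by omega) (by omega)
    rw [Nat.sub_add_cancel (by omega)] at this
    exact (discreteDomainGraph_adj_iff.1 this).2.2

/-! ### Sites off the lattice domain and the abscissa `Rbig` -/

/-- Sites east of the whole trace are off the lattice domain. [folklore] -/
theorem mono_notMem_Λ_of_east (cfg : FarTipCfg D) {y : Site 2} (hy : ∀ x ∈ cfg.C.support, x 0 < y 0) : y ∉ cfg.Λ :=
  fun h => Negative.notMem_dom_of_forall_lt cfg.C cfg.hδ hy (meshDomain_subset_meshVertices _ _ h)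

/-- **An abscissa beyond the free set, the piece and the trace.** [folklore] -/
theorem mono_Rbig (cfg : FarTipCfg D) (F : Finset (Site 2)) (i'' : ℕ) :
    ∃ Rbig : ℤ, (∀ z ∈ F, z 0 + 2 ≤ Rbig) ∧ (∀ m, i'' ≤ m → m ≤ cfg.pend i'' → (cfg.γ.getVert m) 0 + 2 ≤ Rbig) ∧
      (∀ x ∈ cfg.C.support, x 0 + 2 ≤ Rbig) := by
  classical
  set T : Finset (Site 2) := F ∪ (Finset.Icc i'' (cfg.pend i'')).image cfg.γ.getVert ∪ cfg.C.support.toFinset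
    with hT
  have hc : cfg.c ∈ T := by
    rw [hT, Finset.mem_union]
    exact Or.inr (List.mem_toFinset.2 cfg.C.start_mem_support)
  obtain ⟨E, -, hmax⟩ := T.exists_max_image (fun z : Site 2 => z 0) ⟨cfg.c, hc⟩
  refine ⟨E 0 + 2, fun z hz => ?_, fun m h1 h2 => ?_, fun x hx => ?_⟩
  · have := hmax z (by rw [hT, Finset.mem_union, Finset.mem_union]; exact Or.inl (Or.inl hz))
    omega
  · have := hmax (cfg.γ.getVert m) (by
      rw [hT, Finset.mem_union, Finset.mem_union]
      exact Or.inl (Or.inr (Finset.mem_image.2 ⟨m, Finset.mem_Icc.2 ⟨h1, h2⟩, rfl⟩)))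
    omega
  · have := hmax x (by rw [hT, Finset.mem_union]; exact Or.inr (List.mem_toFinset.2 hx))
    omega

/-! ### Escapes -/

section Escapes

variable (cfg : FarTipCfg D) (F : Finset (Site 2)) {i'' : ℕ} {Rbig : ℤ}

/-- Sites off the lattice domain are off `F ⊆ Λ` and are not interior vertices of a non-degenerate piece.
[folklore] -/
theorem mono_avoid_of_notMem_Λ (h : i'' ∈ cfg.farStarts) (hnd : cfg.NonDeg i'') (hFΛ : ∀ x ∈ F, x ∈ cfg.Λ)
    {z : Site 2} (hz : z ∉ cfg.Λ) : z ∉ F ∧ ∀ m, i'' < m → m < cfg.pend i'' → z ≠ cfg.γ.getVert m :=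
  ⟨fun hzF => hz (hFΛ z hzF), fun _ h1 h2 heq => hz (heq ▸ mono_interior_mem_Λ cfg h hnd h1 h2)⟩

/-- Spine sites are off `F` (which is off `K ⊇ Sp`) and are not interior vertices of a piece. [folklore] -/
theorem mono_avoid_of_mem_Sp (h : i'' ∈ cfg.farStarts) (hFK : ∀ x ∈ F, x ∉ cfg.K) {z : Site 2} (hz : z ∈ cfg.Sp) :
    z ∉ F ∧ ∀ m, i'' < m → m < cfg.pend i'' → z ≠ cfg.γ.getVert m :=
  ⟨fun hzF => hFK z hzF (by rw [FarTipCfg.K_def, Finset.mem_union]; exact Or.inl hz),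
    fun _ h1 h2 heq => mono_interior_notMem_Sp cfg h h1 h2 (heq ▸ hz)⟩

/-- **Escape from a trace site**: east of the trace through non-domain sites (`noFloatingHoles`), then due
east to abscissa `≥ Rbig`. [folklore] -/
theorem mono_escape_of_mem_support (h : i'' ∈ cfg.farStarts) (hnd : cfg.NonDeg i'') (hFΛ : ∀ x ∈ F, x ∈ cfg.Λ)
    {q : Site 2} (hq : q ∈ cfg.C.support) :
    ∃ (c' : Site 2) (ε : (zdGraph 2).Walk q c'), Rbig ≤ c' 0 ∧
      ∀ z ∈ ε.support, z ∉ F ∧ ∀ m, i'' < m → m < cfg.pend i'' → z ≠ cfg.γ.getVert m := by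
  obtain ⟨u', p', hu', hp'⟩ := Negative.noFloatingHoles cfg.C cfg.hδ hq
  obtain ⟨b, w, hb0, -, hw⟩ := mono_eastWalk u' (Rbig - u' 0).toNat
  refine ⟨b, p'.append w, ?_, fun z hz => mono_avoid_of_notMem_Λ cfg F h hnd hFΛ ?_⟩
  · rw [hb0]
    have := Int.self_le_toNat (Rbig - u' 0)
    omega
  · rw [SimpleGraph.Walk.mem_support_append_iff] at hz
    rcases hz with hz | hz
    · exact fun hzΛ => hp' z hz (meshDomain_subset_meshVertices _ _ hzΛ)
    · refine mono_notMem_Λ_of_east cfg fun x hx => ?_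
      have h₁ := (hw z hz).1
      have h₂ := hu' x hx
      omega

/-- **Escape from a spine site**: along its attachment walk (spine and trace sites) to the trace, then the
trace escape. [folklore] -/
theorem mono_escape_of_mem_Sp (h : i'' ∈ cfg.farStarts) (hnd : cfg.NonDeg i'') (hFΛ : ∀ x ∈ F, x ∈ cfg.Λ)
    (hFK : ∀ x ∈ F, x ∉ cfg.K) {s : Site 2} (hs : s ∈ cfg.Sp) :
    ∃ (c' : Site 2) (ε : (zdGraph 2).Walk s c'), Rbig ≤ c' 0 ∧
      ∀ z ∈ ε.support, z ∉ F ∧ ∀ m, i'' < m → m < cfg.pend i'' → z ≠ cfg.γ.getVert m := by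
  obtain ⟨q, w, hq, hw⟩ := cfg.hatt s hs
  obtain ⟨c', ε, hc', hε⟩ := mono_escape_of_mem_support cfg F (Rbig := Rbig) h hnd hFΛ hq
  refine ⟨c', w.append ε, hc', fun z hz => ?_⟩
  rw [SimpleGraph.Walk.mem_support_append_iff] at hz
  rcases hz with hz | hz
  · rcases hw z hz with hz' | hz'
    · exact mono_avoid_of_mem_Sp cfg F h hFK hz'
    · exact mono_avoid_of_notMem_Λ cfg F h hnd hFΛ (rest_notMem_Λ_of_mem_support cfg hz')
  · exact hε z hz

/-- **Escape from an exterior chord vertex before the middle**: down the chord to the last spine vertex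
(exterior vertices, off `F`; not interior to the piece of `i''`, else so would be the start), then the spine
escape. [folklore] -/
theorem mono_escape_down (h : i'' ∈ cfg.farStarts) (hnd : cfg.NonDeg i'') (hFΛ : ∀ x ∈ F, x ∈ cfg.Λ)
    (hFK : ∀ x ∈ F, x ∉ cfg.K) {m₀ : ℕ} (hm₀ : m₀ < cfg.τ)
    (hc : ∀ m, i'' < m → m < cfg.pend i'' → cfg.γ.getVert m₀ ≠ cfg.γ.getVert m) :
    ∃ (c' : Site 2) (ε : (zdGraph 2).Walk (cfg.γ.getVert m₀) c'), Rbig ≤ c' 0 ∧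
      ∀ z ∈ ε.support, z ∉ F ∧ ∀ m, i'' < m → m < cfg.pend i'' → z ≠ cfg.γ.getVert m := by
  have hf := cfg.idx_facts
  have hR := rest_isPiece_pend cfg h
  have hGle : cfg.Dg ≤ zdGraph 2 := (discreteDomainGraph_le_meshGraph _ _).trans (meshGraph_le_zdGraph _ _)
  -- the last spine index `i₁ ≤ m₀` and the chord slice down to it
  obtain ⟨i₁, hi₁le, hi₁Sp, hnoSp⟩ := rest_exists_last_spineIdx cfg m₀
  obtain ⟨qs, hqs⟩ := rest_exists_walk_getVert hGle cfg.γ hi₁le (by omega)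
  obtain ⟨c', ε, hc', hε⟩ := mono_escape_of_mem_Sp cfg F (Rbig := Rbig) h hnd hFΛ hFK hi₁Sp
  refine ⟨c', qs.reverse.append ε, hc', fun z hz => ?_⟩
  rw [SimpleGraph.Walk.mem_support_append_iff, SimpleGraph.Walk.support_reverse, List.mem_reverse] at hz
  rcases hz with hz | hz
  · obtain ⟨k, hk1, hk2, rfl⟩ := hqs z hz
    refine ⟨fun hkF => hFK _ hkF ?_, fun m hm1 hm2 heq => ?_⟩
    · rw [FarTipCfg.K_def, Finset.mem_union]
      exact Or.inr (cfg.mem_Ext_iff.2 ⟨k, by omega, Or.inl (by omega), rfl⟩)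
    · have hkm : k = m := mono_γ_inj cfg (by omega) (by have := hR.2.1.1; omega) heq
      subst hkm
      -- the end of the piece of `i''` is a spine index `> k`, hence `> m₀`
      have hpend : m₀ < cfg.pend i'' := lt_of_not_ge fun hle =>
        hnoSp (cfg.pend i'') (by omega) hle (Finset.mem_coe.1 hR.2.1.2)
      exact hc m₀ (by omega) hpend rfl
  · exact hε z hz

/-- **Escape from an exterior chord vertex after the middle**: up the chord to the next spine vertex, then the
spine escape. [folklore] -/
theorem mono_escape_up (h : i'' ∈ cfg.farStarts) (hnd : cfg.NonDeg i'') (hFΛ : ∀ x ∈ F, x ∈ cfg.Λ)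
    (hFK : ∀ x ∈ F, x ∉ cfg.K) {m₀ : ℕ} (hm₀ : cfg.τ' < m₀) (hm₀L : m₀ ≤ cfg.γ.length)
    (hc : ∀ m, i'' < m → m < cfg.pend i'' → cfg.γ.getVert m₀ ≠ cfg.γ.getVert m) :
    ∃ (c' : Site 2) (ε : (zdGraph 2).Walk (cfg.γ.getVert m₀) c'), Rbig ≤ c' 0 ∧
      ∀ z ∈ ε.support, z ∉ F ∧ ∀ m, i'' < m → m < cfg.pend i'' → z ≠ cfg.γ.getVert m := by
  have hR := rest_isPiece_pend cfg h
  have hGle : cfg.Dg ≤ zdGraph 2 := (discreteDomainGraph_le_meshGraph _ _).trans (meshGraph_le_zdGraph _ _)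
  -- the next spine index `j₁ ≥ m₀` and the chord slice up to it
  obtain ⟨j₁, hj₁, hj₁L, hj₁Sp, hnoSp⟩ := rest_exists_first_spineIdx cfg hm₀L
  obtain ⟨qs, hqs⟩ := rest_exists_walk_getVert hGle cfg.γ hj₁ hj₁L
  obtain ⟨c', ε, hc', hε⟩ := mono_escape_of_mem_Sp cfg F (Rbig := Rbig) h hnd hFΛ hFK hj₁Sp
  refine ⟨c', qs.append ε, hc', fun z hz => ?_⟩
  rw [SimpleGraph.Walk.mem_support_append_iff] at hz
  rcases hz with hz | hz
  · obtain ⟨k, hk1, hk2, rfl⟩ := hqs z hz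
    refine ⟨fun hkF => hFK _ hkF ?_, fun m hm1 hm2 heq => ?_⟩
    · rw [FarTipCfg.K_def, Finset.mem_union]
      exact Or.inr (cfg.mem_Ext_iff.2 ⟨k, by omega, Or.inr (by omega), rfl⟩)
    · have hkm : k = m := mono_γ_inj cfg (by omega) (by have := hR.2.1.1; omega) heq
      subst hkm
      -- the start of the piece of `i''` is a spine index `< k`, hence `< m₀`
      have hstart : i'' < m₀ := lt_of_not_ge fun hle =>
        hnoSp i'' hle (by omega) (Finset.mem_coe.1 hR.1.2)
      exact hc m₀ hstart (by omega) rfl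
  · exact hε z hz

/-- **Escape from any attached or trace site that is not interior to the piece.** [folklore] -/
theorem mono_escape (h : i'' ∈ cfg.farStarts) (hnd : cfg.NonDeg i'') (hFΛ : ∀ x ∈ F, x ∈ cfg.Λ)
    (hFK : ∀ x ∈ F, x ∉ cfg.K) {c : Site 2} (hcK : c ∈ cfg.K ∨ c ∈ cfg.C.support)
    (hc : ∀ m, i'' < m → m < cfg.pend i'' → c ≠ cfg.γ.getVert m) :
    ∃ (c' : Site 2) (ε : (zdGraph 2).Walk c c'), Rbig ≤ c' 0 ∧
      ∀ z ∈ ε.support, z ∉ F ∧ ∀ m, i'' < m → m < cfg.pend i'' → z ≠ cfg.γ.getVert m := by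
  rcases hcK with hcK | hcC
  · by_cases hcSp : c ∈ cfg.Sp
    · exact mono_escape_of_mem_Sp cfg F h hnd hFΛ hFK hcSp
    · rw [FarTipCfg.K_def, Finset.mem_union] at hcK
      obtain ⟨m₀, hm₀L, hm₀τ, rfl⟩ := cfg.mem_Ext_iff.1 (hcK.resolve_left hcSp)
      rcases hm₀τ with hlt | hgt
      · exact mono_escape_down cfg F h hnd hFΛ hFK hlt hc
      · exact mono_escape_up cfg F h hnd hFΛ hFK hgt hm₀L hc
  · exact mono_escape_of_mem_support cfg F h hnd hFΛ hcC

end Escapes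

/-! ### The registered part -/

/-- **Witness glue T5, part 3 (registered): escapes of a far-tip configuration.**  For a far start `i''` with a
non-degenerate piece and a site set `F ⊆ Λ` off `K`: an abscissa `Rbig` exceeding by `2` that of every site of
`F` and of every vertex of the piece, such that every site of `K ∪ C.support` that is not an interior vertex of
the piece escapes — by a lattice walk avoiding `F` and the interior of the piece — to abscissa `≥ Rbig`.
[folklore] -/
theorem mono_escapes : ∀ {D : DobrushinDomain} (cfg : FarTipCfg D) (F : Finset (Site 2)) (i'' : ℕ), (∀ x ∈ F, x ∈ cfg.Λ) → (∀ x ∈ F, x ∉ cfg.K) → i'' ∈ cfg.farStarts → cfg.NonDeg i'' → ∃ Rbig : ℤ, (∀ z ∈ F, z 0 + 2 ≤ Rbig) ∧ (∀ m, i'' ≤ m → m ≤ cfg.pend i'' → (cfg.γ.getVert m) 0 + 2 ≤ Rbig) ∧ ∀ c : Site 2, (c ∈ cfg.K ∨ c ∈ cfg.C.support) → (∀ m, i'' < m → m < cfg.pend i'' → c ≠ cfg.γ.getVert m) → ∃ (c' : Site 2) (ε : (zdGraph 2).Walk c c'), Rbig ≤ c' 0 ∧ ∀ z ∈ ε.support,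 z ∉ F ∧ ∀ m, i'' < m → m < cfg.pend i'' → z ≠ cfg.γ.getVert m := by
  intro D cfg F i'' hFΛ hFK h hnd
  obtain ⟨Rbig, hRF, hRγ, -⟩ := mono_Rbig cfg F i''
  exact ⟨Rbig, hRF, hRγ, fun c hcK hc => mono_escape cfg F h hnd hFΛ hFK hcK hc⟩

end Summit.CriticalPhenomena.SAWScalingLimit.Theorems.FKGToTraversalBound.SlitNecklace

end
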